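import Literature.IUT.HodgeArakelov.MonoThetaSymmetries
import Literature.IUT.HodgeArakelov.MonoThetaProjectiveModelSystem

/-!
# [IUTchII] Def. 1.1 (i) / Rmk. 1.1.1 (iii): `(l·ℤ)(M) = Π_X(M)/Π_Y(M) ≅ ℤ` at the [EtTh] model — the field
# `TwoSections.lZ_iso` for the genuine reconstruction

Mochizuki, *Inter-universal Teichmüller theory II*, §1, Def. 1.1 (i) p. 21 ("`(l·ℤ)(M) := Π_X(M)/Π_Y(M)`"),
Rmk. 1.1.1 (iii) pp. 22–23 ("`(l·ℤ)(M) = Δ_X(M)/Δ_Y(M)` … [isomorphic to `l·ℤ`]") [claim: Mochizuki2012, status: disputed]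
(IUTchII §1 Def 1.1 (i), kurims p.21); [EtTh] Def. 2.13 (i) p. 47 "`Gal(Y/X) (≅ l·ℤ)`"
[cite: MochizukiEtTh2009, Def 2.13(i) p.47].

PROOF-ONLY companion (abc-iut cell, seat abc-iut-w4-d030 (gen 2), B8 / ModelFrame lineage) answering abc-iut-w5-d225's
NV-L6/TwoSections producer list item **(P2)** (STATUS 2026-08-26T03:48:59Z: "`Nonempty (R.lZ ≃* Multiplicative ℤ)` with
`Reconstruction.lZ := R.PiX ⧸ R.inclY.range` — at the model `Π^tp_{X̲̲}/Π^tp_{Y̲̲} ≅ l·ℤ`: NOT in the tree; natural owner =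
ModelFrame lineage"): for EVERY [EtTh]-model frame `F : ModelFrame S R` and identification `e` (abc-iut-L6-d6's
`ModelFrame.reconstruction`, B8 part 5b), `Π_X(M) = Π^tp_{X̲̲}`, `Π_Y(M) ↪ Π_X(M)` is the SUBTYPE inclusion of
`Π^tp_{Y̲̲}`, so `(l·ℤ)(M) = Π^tp_{X̲̲} ⧸ Π^tp_{Y̲̲}`, which abc-iut-L2's rigidity data identify with `ℤ` by the field
`ThetaEnvData.galYX : Π^tp_X ⧸ Π^tp_Y ≃* Multiplicative ℤ` ("`Gal(Y/X) (≅ l·ℤ)`", at the [IUTchII] bridge: the `ℤ`-covering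
`Y̲̲ → X̲̲` read through abc-iut-L2-t8's `DoubleUnderline.toLZ`). Hence `ModelFrame.nonempty_lZ_mulEquiv_int` and, at
every level of the natural system of `X̲̲_K` (`EtaleLevels.modelRecon`), `EtaleLevels.nonempty_lZ_mulEquiv_int` — the
field `lZ_iso` of abc-iut-L6-t1's `TwoSections` for the genuine `R`. HONEST FRAMING: a kernel fact about the cell's own
model objects (the identification is the frame's own `galYX`, i.e. as abstract groups — print's `l·ℤ ≅ ℤ`); nothing of
[IUTchII] is asserted; no side taken on [IUTchIII] Cor. 3.12; typed ≠ discharged.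
-/

namespace Literature.IUT.HodgeArakelov

open Literature.AnabelianGeometry.EtaleTheta

universe u

noncomputable section

namespace ModelFrame

variable {S : ThetaSetting.{u}} {l : ℕ} {R : RigidData.{u} S.N l}

/-- **`(l·ℤ)(M) ≅ ℤ` at the [EtTh] model** (Def. 1.1 (i) "`(l·ℤ)(M) := Π_X(M)/Π_Y(M)`"; [EtTh] Def. 2.13 (i)
"`Gal(Y/X) (≅ l·ℤ)`"): for the genuine reconstruction `F.reconstruction e`, `(l·ℤ)(M) = Π^tp_{X̲̲} ⧸ range(Π^tp_{Y̲̲} ↪ Π^tp_{X̲̲})`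
is isomorphic to `Multiplicative ℤ` — by `range_subtype` and the rigidity data's `galYX`. This is the field
`TwoSections.lZ_iso` (Rmk. 1.1.1 (iii)) for the genuine `R`. [claim: Mochizuki2012, status: disputed]
(IUTchII §1 Def 1.1 (i), kurims p.21) -/
theorem nonempty_lZ_mulEquiv_int (F : ModelFrame S R) {M : MonoThetaEnv S} (e : M.Pi ≃ₜ* R.env) :
    Nonempty ((F.reconstruction e).lZ ≃* Multiplicative ℤ) := by
  haveI := (F.reconstruction e).inclY_normal
  haveI := R.PiY_normal
  refine ⟨(QuotientGroup.quotientMulEquivOfEq ?_).trans R.galYX⟩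
  exact Subgroup.range_subtype R.PiY

end ModelFrame

namespace EtaleLevels

open Literature.AnabelianGeometry.SemiGraphs
open scoped Literature.AnabelianGeometry.EtaleTheta

variable {p : ℕ} [Fact p.Prime] {D : Literature.AnabelianGeometry.EtaleTheta.ThetaSetting p}
  {E : D.EtaleThetaData} {l : ℕ} (C : E.DoubleUnderline l) (hC : D.Compat) (hS : D.Sec2Hyps)
  (hl : l.Prime) (hp2 : p ≠ 2) (hpl : p ≠ l) (hζ : ∃ ζ : D.K, IsPrimitiveRoot ζ (4 * l))
  (mods : ∀ M : ℕ+, D.CyclotomeMod l M)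
  (f : contCocycles D.toTheta D.DeltaTheta C.GtpYdduu) (hf : f ∈ C.rootCocycles hC)
  (h15 : Literature.AnabelianGeometry.EtaleTheta.ThetaSetting.Prop15iii E hC) (L : C.CuspLabels)
  (hZ : ∀ M : ℕ+, Nonempty (ModelCyclotomes.lDeltaQuot (C.rigidData (mods M) hC hS h15 L) ≃*
    Literature.IUT.HodgeTheaters.ZHat))

/-- **`(l·ℤ)(𝕄_M) ≅ ℤ` at every level of the natural system of `X̲̲_K`** (`Π_X(𝕄_M)/Π_Y(𝕄_M) = Π^tp_{X̲̲}/Π^tp_{Y̲̲}`, the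
Galois group of the `ℤ`-covering `Y̲̲ → X̲̲`). [claim: Mochizuki2012, status: disputed] (IUTchII §1 Def 1.1 (i), kurims p.21) -/
theorem nonempty_lZ_mulEquiv_int (M : ℕ+) :
    Nonempty ((modelRecon C hC hS hl hp2 hpl hζ mods f hf h15 L hZ M).lZ ≃* Multiplicative ℤ) := by
  unfold modelRecon
  exact ModelFrame.nonempty_lZ_mulEquiv_int (modelFrame C hC hS hl hp2 hpl hζ mods f hf h15 L hZ M) _

end EtaleLevels

end

end Literature.IUT.HodgeArakelov
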